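import Literature.Analysis.FluidPDE.Tao2016AveragedNS.CriticalBudget
import Literature.Analysis.FluidPDE.Tao2016AveragedNS.GateCertificateWith
import Literature.Analysis.FluidPDE.FluidComputer.CertificateContinuation
import Literature.Analysis.FluidPDE.FluidComputer.CertificateRefinement
import HarnessLib

/-!
# Tao's gate inhabits the cell's reach interface at the seed scale — and no further

Note for the FLUID COMPUTER cell (pub-fluidc, blueprint seat bp1). HONEST FRAMING: this is a
low prior, high value-of-information experiment on Tao's machine paradigm
[Tao2016AveragedNS, §1.3, §5.5]; NOT a claim that NS blows up. Everything here is
finite-dimensional: theorems about Tao's five-mode delay circuit `delayCircuitWith K M ε` (an ODE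
on `ℝ⁵`) and the cell's REACH INTERFACE `FluidComputer.ReachCertificate F U ε τc Ain Aout`
(ReachCertificate.lean, seat bp3): a robust reach–avoid certificate for the differential
inclusion `x' ∈ F(x) + B̄(0, ε)` on the open working region `U` — every continuous curve on
`[0, σT]`, `σT ≤ τc`, from `p ∈ Ain`, in `U` on `[0, σT)` with right derivative `ε`-close to `F`,
ends in a tube `Tube p σT ⊆ U` and, if `σT = τc`, has visited `Aout`. The dynamics layer of the
cell's blueprint (ReachCircuit.lean) consumes exactly this object; the only inhabitant recorded so
far for Tao's gate is the GRÖNWALL one (`taoGate`, `taoGateWith`: GateCertificate(With).lean, via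
`ReachCertificate.ofFlow`), whose defect budget is `ρ + 2εd ≤ θ·e^{-2L}` with
`2L = 2·delayLipschitzWith K M ε 2 ≥ 16/ε²` — "absurdly small" (DICTIONARY §12, §15).

This file replaces it by the SHARP one and shows that nothing better exists in this interface.
Notation: `u := ε²e^{-M}/√M`; standing hypotheses `K ≥ 2·20⁴²·42! + 16`, `3000 log K ≤ M ≤ K¹⁰`,
`0 < ε ≤ e^{-10M}K^{-100}`; input class `Ain = closedBall delayInit ρ` (sup norm of `ℝ⁵`,
`delayInit` = Tao's datum (5.6)), defect level `εd`, cycle time `τc = 2`, output class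
`firedSet K e m = {|ã - 1| ≤ e/K²⁰, |a|,|b|,|c|,|d| ≤ m/K¹⁰}` (the state of `FiredOn`,
SeedScaleSharpClosure.lean).

* §1 `firedSet` and its bookkeeping (`firedOn_iff_mem_firedSet`, closed,
  `⊆ firedOut (max e m) K 0` of GateCertificate.lean, `⊆ {ã ≥ 1/2}` for `e ≤ K²⁰/2`).
* §2 admissible curves of the interface over the open sup-ball of radius `2` ARE pseudo-orbits of
  CircuitShadowing.lean (`isPseudoOrbit_of_admissible`), and their energy drifts by at most
  `7ρ + 40εd` (`energy_le_of_admissible`): they stay in the closed sup-ball of radius `3/2`.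
* §3 SUFFICIENCY, hypothesis-light: `reachCertificateOfFires` — `FiresUnderBudget K M ε e m B`
  (CriticalBudget.lean) with `ρ + 2εd ≤ B` and `7ρ + 40εd ≤ 5/4` IS a reach certificate
  `ReachCertificate (delayCircuitWith K M ε) (ball 0 2) εd 2 (closedBall delayInit ρ) (firedSet K e m)`
  (tube = the closed ball of radius `3/2`; REACH at `σT = 2` = the fired state at time `2`).
* §4 under the standing hypotheses: `taoReachSharp` — a certificate for EVERY `ρ, εd ≥ 0` with
  `ρ + 2εd < 1.2532·u` (output class `firedSet K 6 4`, the fired state of Theorem 5.3);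
  `reachCertificateOfLtCriticalBudget` — for every budget below `criticalBudget K M ε e m`;
  over any larger working region (`taoReachSharp_enlarge`); into bp3's `firedOut 6 K 0`
  (`taoReachSharp_firedOut`).
* §5 NECESSITY: `isEmpty_reachCertificate_of_ge` — for ANY open working region, ANY defect level
  `εd ≥ 0`, ANY cycle time `τc ≤ 2`, any input class containing `closedBall delayInit ρ` with
  `ρ ≥ 1.2535·u` and any output class inside `{ã > 6e^{-M}}` there is NO reach certificate: the
  pinned negative-kick dud (`exists_negativeKick_dud_pinned`, NegativeKickThreshold.lean) is an
  admissible curve with defect `0` that keeps `|ã| ≤ 6e^{-M}` for the whole cycle, while the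
  interface's own continuation principle (`ReachCertificate.reach`, CertificateContinuation.lean)
  would make it visit `Aout`. Corollaries for `firedSet K e m` (`e ≤ K²⁰/2`) and for bp3's
  `firedOut C K θ` (`C/K¹⁰ + θ ≤ 1/2`). The obstruction is ONE explicit datum
  (`isEmpty_reachCertificate_of_negKick`: any input class containing the negative-kick segment
  `{kickInit (-κ) : 1.2532·u < κ < 1.2535·u}` is obstructed) — a NEGATIVE pre-load of the trigger
  mode; positive pre-loads fire EARLY (TriggerFragility.lean) and are not a reach obstruction, so
  the two-sided threshold is a statement about balls around `delayInit`.
* §5b THE DEFECT AXIS (no standing hypotheses): `isEmpty_reachCertificate_of_seed_le` — at defect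
  levels `εd ≥ ε²e^{-M}` (the member's SEED RATE `s = u√M`) there is NO reach certificate for ANY
  open working region, ANY cycle time `τc ≥ 0`, ANY input class containing (5.6) and ANY output
  class missing `{ã = 0}`: the seed-free orbit of GateFragility.lean / SeedCancellation.lean
  (`(sech εt, tanh εt, 0, 0, 0)`, defect `ε²e^{-M}a²`, `ã ≡ 0`) is admissible. Corollaries for
  `firedSet K e m` (`e < K²⁰`), `firedOut C K θ` (`C/K¹⁰ + θ < 1`), the classes of §4
  (`isEmpty_taoReach_of_seed_le`). On the defect axis the two sides are a factor `≥ 1.59√M` apart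
  (certified for `2εd < 1.2532·u`, impossible from `εd ≥ u√M`); which side is lossy is not decided.
* §6 TUNINGS, both sides: Tao's own gate (5.5) (`M = K¹⁰`): certified for
  `ρ + 2εd < 1.2532·ε²e^{-K¹⁰}/K⁵` (`taoReach`), impossible from `ρ ≥ 1.2535·ε²e^{-K¹⁰}/K⁵`
  (`isEmpty_taoReach_of_ge_pow_ten`); the log-retuned members `M = p log K` (`p ≥ 3000`): certified
  for the POLYNOMIAL budget `ρ + 2εd < 1.2532·ε²/(K^p√(p log K))` (`taoReachLog`; in particular for
  `ρ + 2εd ≤ ε²/K^{p+5}`, `taoReachLogPow`), impossible from `ρ ≥ 1.2535·ε²/(K^p√(p log K))`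
  (`isEmpty_taoReachLog_of_ge`); on the defect axis: impossible at every cycle time from
  `εd ≥ ε²e^{-K¹⁰}` (`isEmpty_taoReach_of_seed_le_pow_ten`), resp. from the POLYNOMIAL seed rate
  `εd ≥ ε²/K^p` (`isEmpty_taoReachLog_of_seed_le`; any `K ≥ 2`, any `ε`).
* §7 THE CERTIFIABLE RADIUS AS ONE NUMBER: `reachRadius K M ε εd := sSup {ρ | a certificate with
  input radius ρ and defect εd exists}` is a threshold (`reachRadius_threshold`), lies in
  `[1.2532·u - 2εd, 1.2535·u]` (`reachRadius_mem_Icc`), and at `εd = 0` agrees with the critical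
  budget of CriticalBudget.lean to `3·10⁻⁴·u` (`reachRadius_sub_criticalBudget`): in the cell's own
  interface, the certifiable robustness of Tao's gate IS the critical budget `√(π/2)·u·(1 ± 3·10⁻⁴)`.
  At `εd ≥ ε²e^{-M}` it collapses: `reachRadius K M ε εd = 0`, only the vacuous negative radii being
  certified (`reachRadius_eq_zero_of_seed_le`, `reachCertificateVacuous`). The whole `(ρ, εd)` plane:
  `taoReach_phases` (certified triangle `ρ + 2εd < 1.2532·u`; impossible half-planes `ρ ≥ 1.2535·u`
  and `εd ≥ ε²e^{-M}`; `dud_level_lt_seed`: `1.2535·u < ε²e^{-M}`).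
* §8 VERSUS GRÖNWALL: `shadowRadiusWith K M ε 2 2 θ < 1.2532·u` for `0 ≤ θ ≤ 1`
  (`shadowRadiusWith_lt_sharp`; indeed `θe^{-16/ε²}·√M < ε²e^{-M}`), so every Grönwall gate budget
  `GateBudgetWith K M ε ρ εd θ` of GateCertificateWith.lean is a sharp reach budget
  (`GateBudgetWith.budget_lt_sharp`, `GateBudgetWith.reachCertificate`) — the interface now admits
  budgets larger by a factor `≥ e^{15/ε²}`, up to the seed scale, and (§5) not beyond.

What this says for the dictionary "Tao's circuit element ↔ gadget-interface field": in the type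
the assembly consumes, the finite-dimensional half of a local design built on Tao's gate is a
THEOREM with defect budget `hand-off error + 2·defect < 1.2532·ε²e^{-M}/√M` (rescaled sup-norm
units), and this is optimal to `3·10⁻⁴` in the hand-off error: what the true equations would
have to supply (`ReachCircuit`'s `defect` field) is a defect below the gate's SEED SCALE — certified
below `0.6266·ε²e^{-M}/√M`, impossible from the seed rate `ε²e^{-M}` on (§5b); polynomial
(`ε²/(K^p√(p log K))`, resp. `ε²/K^p`) on the log-retuned members, `e^{-K¹⁰}`-small on Tao's.
What it does NOT say: anything about Navier–Stokes (no `ReachCircuit` over these certificates is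
constructed or claimed); anything for cycle times `τc > 2` on the pre-load side of necessity (the
dud fires late; the defect side §5b holds at every cycle time); anything about output classes
meeting `{ã ≤ 6e^{-M}}` (pre-load side) or containing a point with `ã = 0` (defect side).

Design choices. (i) The certificate is built from the PROPOSITION `FiresUnderBudget` (§3), so the
standing hypotheses enter only through CriticalBudget.lean's `firesUnderBudget_of_lt` /
`criticalBudget_threshold`; (ii) the tube is the coarse closed ball of radius `3/2` (energy drift),
which is all the interface's AVOID clause needs — the timed portrait of PseudoOrbitTimingSharp.lean
is not threaded into the tube; (iii) the necessity theorem quantifies over all `U, εd, τc ≤ 2, Ain,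
Aout` as stated, so it applies verbatim to any re-targeting (`monoIn`/`monoOut`/`enlarge`,
CertificateRefinement.lean) of any certificate; (iv) no named facts, no `sorry`, no `set_option`.

## References
* T. Tao, *Finite time blowup for an averaged three-dimensional Navier–Stokes equation*, J. Amer.
  Math. Soc. 29 (2016) 601–674, arXiv:1402.0290: §5.5 (5.5)–(5.6), Theorem 5.3; §1.3 pp. 10–11.
  [`Tao2016AveragedNS`]
* E. Hairer, S. P. Nørsett, G. Wanner, *Solving Ordinary Differential Equations I*, 2nd ed.,
  Springer 1993, Thm I.10.2. [`HairerNorsettWanner1993`]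
-/

noncomputable section

open Real Set Metric
open scoped NNReal

namespace Literature.Analysis.FluidPDE.Tao2016AveragedNS

open Literature.Analysis.FluidPDE.FluidComputer (ReachCertificate)

/-! ## §1. The fired set -/

/-- **The fired set** with tolerances `(e, m)`: `|ã - 1| ≤ e/K²⁰` and `|a|, |b|, |c|, |d| ≤ m/K¹⁰`
— the state of `FiredOn` (SeedScaleSharpClosure.lean), i.e. the conclusion of
[Tao2016AveragedNS, Theorem 5.3] at one instant. [cite: Tao2016AveragedNS, §5.5 Theorem 5.3] -/
def firedSet (K e m : ℝ) : Set (Fin 5 → ℝ) :=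
  {p | |p 4 - 1| ≤ e / K ^ 20 ∧ ∀ i : Fin 5, i ≠ 4 → |p i| ≤ m / K ^ 10}

/-- Membership in the fired set, unfolded. [folklore] -/
theorem mem_firedSet_iff {K e m : ℝ} {p : Fin 5 → ℝ} :
    p ∈ firedSet K e m ↔ |p 4 - 1| ≤ e / K ^ 20 ∧ ∀ i : Fin 5, i ≠ 4 → |p i| ≤ m / K ^ 10 :=
  Iff.rfl

/-- `FiredOn K Y S e m` says exactly that `Y t ∈ firedSet K e m` for every `t ∈ S`.
[cite: Tao2016AveragedNS, §5.5 Theorem 5.3] -/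
theorem firedOn_iff_mem_firedSet {K : ℝ} {Y : ℝ → Fin 5 → ℝ} {S : Set ℝ} {e m : ℝ} :
    FiredOn K Y S e m ↔ ∀ t ∈ S, Y t ∈ firedSet K e m :=
  Iff.rfl

/-- The fired set is closed. [folklore] -/
theorem isClosed_firedSet (K e m : ℝ) : IsClosed (firedSet K e m) := by
  have h1 : IsClosed {p : Fin 5 → ℝ | |p 4 - 1| ≤ e / K ^ 20} :=
    isClosed_le ((continuous_apply 4).sub continuous_const).abs continuous_const
  have h2 : ∀ i : Fin 5, IsClosed {p : Fin 5 → ℝ | i ≠ 4 → |p i| ≤ m / K ^ 10} := by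
    intro i
    by_cases hi : i = 4
    · have : {p : Fin 5 → ℝ | i ≠ 4 → |p i| ≤ m / K ^ 10} = univ :=
        eq_univ_of_forall fun p h => absurd hi h
      rw [this]
      exact isClosed_univ
    · have : {p : Fin 5 → ℝ | i ≠ 4 → |p i| ≤ m / K ^ 10} = {p | |p i| ≤ m / K ^ 10} := by
        ext p
        simp [hi]
      rw [this]
      exact isClosed_le (continuous_apply i).abs continuous_const
  have h3 : firedSet K e m =
      {p : Fin 5 → ℝ | |p 4 - 1| ≤ e / K ^ 20} ∩ ⋂ i : Fin 5, {p | i ≠ 4 → |p i| ≤ m / K ^ 10} := by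
    ext p
    simp only [firedSet, mem_setOf_eq, mem_inter_iff, mem_iInter]
  rw [h3]
  exact h1.inter (isClosed_iInter h2)

/-- The output mode on the fired set: `ã ≥ 1 - e/K²⁰`. [cite: Tao2016AveragedNS, §5.5 Theorem 5.3] -/
theorem four_ge_of_mem_firedSet {K e m : ℝ} {p : Fin 5 → ℝ} (hp : p ∈ firedSet K e m) :
    1 - e / K ^ 20 ≤ p 4 := by
  have := (abs_sub_le_iff.1 hp.1).2
  linarith

/-- For tolerances `e ≤ K²⁰/2` the fired set lies in `{ã ≥ 1/2}` ("fired" separates `ã ≈ 1` from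
`ã ≈ 0`). [cite: Tao2016AveragedNS, §5.5 Theorem 5.3] -/
theorem firedSet_subset_half {K e m : ℝ} (hK : 0 < K) (he : e ≤ K ^ 20 / 2) :
    firedSet K e m ⊆ {p | 1 / 2 ≤ p 4} := by
  intro p hp
  have hK20 : (0 : ℝ) < K ^ 20 := by positivity
  have heK : e / K ^ 20 ≤ 1 / 2 := by rw [div_le_iff₀ hK20]; linarith
  have := four_ge_of_mem_firedSet hp
  show 1 / 2 ≤ p 4
  linarith

/-- The fired set lies in bp3's output class `firedOut (max e m) K 0` of GateCertificate.lean
(`K ≥ 1`, `e ≥ 0`). [cite: Tao2016AveragedNS, §5.5 Theorem 5.3] -/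
theorem firedSet_subset_firedOut {K e m : ℝ} (hK : 1 ≤ K) (he : 0 ≤ e) :
    firedSet K e m ⊆ firedOut (max e m) K 0 := by
  intro p hp
  rw [mem_firedOut_iff]
  have hK10 : (0 : ℝ) < K ^ 10 := by positivity
  have hpow : K ^ 10 ≤ K ^ 20 := pow_le_pow_right₀ hK (by norm_num)
  have h1 : e / K ^ 20 ≤ e / K ^ 10 := div_le_div_of_nonneg_left he hK10 hpow
  have h2 : e / K ^ 10 ≤ max e m / K ^ 10 := div_le_div_of_nonneg_right (le_max_left e m) hK10.le
  have h3 : m / K ^ 10 ≤ max e m / K ^ 10 := div_le_div_of_nonneg_right (le_max_right e m) hK10.le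
  refine ⟨?_, fun i hi => ?_⟩
  · have := four_ge_of_mem_firedSet hp
    linarith
  · have := hp.2 i hi
    linarith

/-! ## §2. Admissible curves of the interface are pseudo-orbits; energy confinement -/

/-- **The interface's curves are pseudo-orbits.** A continuous curve on `[0, σT]` lying in the open
sup-ball of radius `2` on `[0, σT)` with right derivative `εd`-close to `F` there is an
`εd`-pseudo-orbit of `F` in the sup-ball of radius `2` over `[0, σT]` (CircuitShadowing.lean).
[cite: HairerNorsettWanner1993, Thm I.10.2] -/
theorem isPseudoOrbit_of_admissible {F : (Fin 5 → ℝ) → (Fin 5 → ℝ)} {εd σT : ℝ}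
    {x : ℝ → Fin 5 → ℝ} (hcont : ContinuousOn x (Icc 0 σT))
    (hU : ∀ σ ∈ Ico 0 σT, x σ ∈ ball (0 : Fin 5 → ℝ) 2)
    (hW : ∀ σ ∈ Ico 0 σT, ∃ W : Fin 5 → ℝ, HasDerivWithinAt x W (Ici σ) σ ∧ ‖W - F (x σ)‖ ≤ εd) :
    IsPseudoOrbit F εd 2 σT x where
  continuousOn := hcont
  defect := hW
  norm_le := fun σ hσ => by
    have h := hU σ hσ
    rw [mem_ball_zero_iff] at h
    have h2 : ((2 : ℝ≥0) : ℝ) = 2 := by norm_num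
    rw [h2]
    exact h.le

/-- **Energy confinement.** Along an `εd`-pseudo-orbit of a member in the sup-ball of radius `2`
over `[0, σT]`, `σT ≤ 2`, issued `ρ`-close to (5.6) (`ρ ≤ 1`), the energy at time `σT` is at most
`1 + 7ρ + 40εd` (the design field cancels; `IsPseudoOrbit.abs_energy_sub_le`,
`Ignition.abs_energy_init_le`). [cite: Tao2016AveragedNS, §5 (g-cancel)] -/
theorem energy_le_of_admissible {K M ε εd σT ρ : ℝ} {x : ℝ → Fin 5 → ℝ}
    (hx : IsPseudoOrbit (delayCircuitWith K M ε) εd 2 σT x) (hσ0 : 0 ≤ σT) (hσT : σT ≤ 2)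
    (h0 : ‖x 0 - delayInit‖ ≤ ρ) (hρ1 : ρ ≤ 1) (hεd : 0 ≤ εd) :
    energy (x σT) ≤ 1 + 7 * ρ + 40 * εd := by
  have h1 := hx.abs_energy_sub_le (t := σT) ⟨hσ0, le_rfl⟩
  have h2 := Ignition.abs_energy_init_le h0 hρ1
  have h3 := (abs_le.1 h1).2
  have h4 := (abs_le.1 h2).2
  nlinarith [mul_nonneg hεd (sub_nonneg.2 hσT)]

/-- Energy `≤ 9/4` confines the state to the closed sup-ball of radius `3/2`.
[cite: Tao2016AveragedNS, §5.5 (energy-con)] -/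
theorem norm_le_three_halves_of_energy_le {p : Fin 5 → ℝ} (hE : energy p ≤ 9 / 4) :
    ‖p‖ ≤ 3 / 2 := by
  refine (norm_le_sqrt_energy p).trans ?_
  have : Real.sqrt (9 / 4 : ℝ) = 3 / 2 := by
    rw [show (9 / 4 : ℝ) = (3 / 2) ^ 2 by norm_num, Real.sqrt_sq (by norm_num)]
  rw [← this]
  exact Real.sqrt_le_sqrt hE

/-- A datum `ρ`-close to (5.6) with `ρ ≤ 5/28` lies in the closed sup-ball of radius `3/2`.
[cite: Tao2016AveragedNS, §5.5 (5.6)] -/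
theorem norm_le_three_halves_of_near {p : Fin 5 → ℝ} {ρ : ℝ} (hp : ‖p - delayInit‖ ≤ ρ)
    (hρ : ρ ≤ 5 / 28) : ‖p‖ ≤ 3 / 2 := by
  have h := (abs_le.1 (Ignition.abs_energy_init_le hp (by linarith))).2
  exact norm_le_three_halves_of_energy_le (by linarith)

/-! ## §3. Sufficiency, hypothesis-light: a firing budget IS a reach certificate -/

/-- **A firing budget is a reach certificate.** If every pseudo-orbit of the member within total
budget `B` fires on `[2,T]` at tolerance `(e, m)` (`FiresUnderBudget K M ε e m B`,
CriticalBudget.lean), then for every input radius `ρ` and defect level `εd ≥ 0` with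
`ρ + 2εd ≤ B` (and the harmless size condition `7ρ + 40εd ≤ 5/4`) the cell's reach interface is
inhabited: `F = delayCircuitWith K M ε`, `U` = the open sup-ball of radius `2`, defect `εd`, cycle
time `τc = 2`, `Ain = closedBall delayInit ρ`, `Aout = firedSet K e m`; tube = the closed sup-ball
of radius `3/2` (energy confinement, §2); REACH at `σT = 2`: the curve is a pseudo-orbit on `[0,2]`
with budget `ρ + 2εd ≤ B`, hence fired at time `2`. [cite: Tao2016AveragedNS, §5.5 Theorem 5.3] -/
def reachCertificateOfFires {K M ε e m B ρ εd : ℝ} (hF : FiresUnderBudget K M ε e m B)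
    (hεd : 0 ≤ εd) (hB : ρ + εd * 2 ≤ B) (hsm : 7 * ρ + 40 * εd ≤ 5 / 4) :
    ReachCertificate (delayCircuitWith K M ε) (ball (0 : Fin 5 → ℝ) 2) εd 2
      (closedBall delayInit ρ) (firedSet K e m) where
  Tube _ _ := closedBall (0 : Fin 5 → ℝ) (3 / 2)
  Tube_closed _ _ := by
    have h : {z : ℝ × (Fin 5 → ℝ) | z.1 ∈ Icc (0 : ℝ) 2 ∧ z.2 ∈ closedBall (0 : Fin 5 → ℝ) (3 / 2)}
        = Icc (0 : ℝ) 2 ×ˢ closedBall (0 : Fin 5 → ℝ) (3 / 2) := by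
      ext z
      simp
    rw [h]
    exact isClosed_Icc.prod isClosed_closedBall
  Tube_zero p hp := by
    rw [mem_closedBall, dist_eq_norm] at hp
    rw [mem_closedBall_zero_iff]
    exact norm_le_three_halves_of_near hp (by linarith)
  Tube_sub _ _ _ _ := by
    intro q hq
    rw [mem_closedBall_zero_iff] at hq
    rw [mem_ball_zero_iff]
    linarith
  cert p hp σT x h0 hσT hx0 hcont hU hW := by
    have hx : IsPseudoOrbit (delayCircuitWith K M ε) εd 2 σT x :=
      isPseudoOrbit_of_admissible hcont hU hW
    have hp' : ‖x 0 - delayInit‖ ≤ ρ := by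
      rw [hx0]
      rwa [mem_closedBall, dist_eq_norm] at hp
    have hρ1 : ρ ≤ 1 := by linarith
    refine ⟨?_, fun h2 => ?_⟩
    · have hE := energy_le_of_admissible hx h0 hσT hp' hρ1 hεd
      rw [mem_closedBall_zero_iff]
      exact norm_le_three_halves_of_energy_le (by linarith)
    · subst h2
      exact ⟨2, ⟨by norm_num, le_rfl⟩, hF εd ρ 2 x le_rfl hx hp' hB 2 ⟨le_rfl, le_rfl⟩⟩

/-- The tube of the certificate is the closed sup-ball of radius `3/2`. [folklore] -/
theorem reachCertificateOfFires_tube {K M ε e m B ρ εd : ℝ} (hF : FiresUnderBudget K M ε e m B)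
    (hεd : 0 ≤ εd) (hB : ρ + εd * 2 ≤ B) (hsm : 7 * ρ + 40 * εd ≤ 5 / 4)
    (p : Fin 5 → ℝ) (σ : ℝ) :
    (reachCertificateOfFires hF hεd hB hsm).Tube p σ = closedBall (0 : Fin 5 → ℝ) (3 / 2) :=
  rfl

/-! ## §4. Under the standing hypotheses: certificates up to the seed scale -/

section Standing

variable {K M ε : ℝ} (hK : 2 * 20 ^ 42 * (Nat.factorial 42 : ℝ) + 16 ≤ K)
  (hML : 3000 * Real.log K ≤ M) (hMK : M ≤ K ^ 10) (hε : 0 < ε)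
  (hεle : ε ≤ exp (-(10 * M)) / K ^ 100)
include hK hML hMK hε hεle

/-- The two levels are tiny: `1.2532·u ≤ 1.2535·u ≤ 1/50` (`u = ε²e^{-M}/√M`).
[cite: Tao2016AveragedNS, §5.5 Theorem 5.3] -/
theorem dud_level_le :
    3133 / 2500 * (ε ^ 2 * exp (-M)) / Real.sqrt M ≤ 2507 / 2000 * (ε ^ 2 * exp (-M)) / Real.sqrt M ∧
      2507 / 2000 * (ε ^ 2 * exp (-M)) / Real.sqrt M ≤ 1 / 50 := by
  obtain ⟨-, -, hε2, hexpM, -, -, -, hsq77, -⟩ := Ignition.ignition_params hK hML hMK hε hεle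
  have hsq0 : 0 < Real.sqrt M := by linarith
  have hs : 0 ≤ ε ^ 2 * exp (-M) := by positivity
  have hs' : ε ^ 2 * exp (-M) ≤ 1 / 100000 * (1 / 1000000) :=
    mul_le_mul hε2 hexpM (exp_pos _).le (by norm_num)
  refine ⟨div_le_div_of_nonneg_right (by linarith) hsq0.le, ?_⟩
  rw [div_le_iff₀ hsq0]
  linarith

/-- **Tao's gate inhabits the reach interface up to the seed scale.** For every member under the
standing hypotheses and every input radius `ρ ≥ 0` and defect level `εd ≥ 0` with
`ρ + 2εd < 1.2532·ε²e^{-M}/√M`: a reach certificate over the open sup-ball of radius `2`, cycle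
time `2`, from `closedBall delayInit ρ` into the fired set of Theorem 5.3 (`|ã - 1| ≤ 6K⁻²⁰`,
`|a|,|b|,|c|,|d| ≤ 4K⁻¹⁰`). Compare the Grönwall inhabitant `taoGateWith`
(GateCertificateWith.lean): `ρ + 2εd ≤ θe^{-2L}`, `2L ≥ 16/ε²` (§7).
[cite: Tao2016AveragedNS, §5.5 Theorem 5.3] -/
def taoReachSharp {ρ εd : ℝ} (hρ : 0 ≤ ρ) (hεd : 0 ≤ εd)
    (hB : ρ + εd * 2 < 3133 / 2500 * (ε ^ 2 * exp (-M)) / Real.sqrt M) :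
    ReachCertificate (delayCircuitWith K M ε) (ball (0 : Fin 5 → ℝ) 2) εd 2
      (closedBall delayInit ρ) (firedSet K 6 4) :=
  reachCertificateOfFires
    (firesUnderBudget_of_lt hK hML hMK hε hεle hB (by norm_num) (by norm_num)) hεd le_rfl
    (by obtain ⟨h1, h2⟩ := dud_level_le hK hML hMK hε hεle; linarith)

/-- The tube of `taoReachSharp` is the closed sup-ball of radius `3/2`. [folklore] -/
theorem taoReachSharp_tube {ρ εd : ℝ} (hρ : 0 ≤ ρ) (hεd : 0 ≤ εd)
    (hB : ρ + εd * 2 < 3133 / 2500 * (ε ^ 2 * exp (-M)) / Real.sqrt M) (p : Fin 5 → ℝ) (σ : ℝ) :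
    (taoReachSharp hK hML hMK hε hεle hρ hεd hB).Tube p σ = closedBall (0 : Fin 5 → ℝ) (3 / 2) :=
  rfl

/-- **Every budget below the critical budget is certified**, at every tolerance
`6 ≤ e ≤ K²⁰/2`, `4 ≤ m` (`criticalBudget_threshold`, CriticalBudget.lean).
[cite: Tao2016AveragedNS, §5.5 Theorem 5.3] -/
def reachCertificateOfLtCriticalBudget {e m ρ εd : ℝ} (he : 6 ≤ e) (he' : e ≤ K ^ 20 / 2)
    (hm : 4 ≤ m) (hρ : 0 ≤ ρ) (hεd : 0 ≤ εd) (hB : ρ + εd * 2 < criticalBudget K M ε e m) :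
    ReachCertificate (delayCircuitWith K M ε) (ball (0 : Fin 5 → ℝ) 2) εd 2
      (closedBall delayInit ρ) (firedSet K e m) :=
  reachCertificateOfFires ((criticalBudget_threshold hK hML hMK hε hεle he he' hm).1 _ hB) hεd
    le_rfl
    (by
      have h1 := (criticalBudget_mem_Icc hK hML hMK hε hεle he he' hm).2
      obtain ⟨-, h2⟩ := dud_level_le hK hML hMK hε hεle
      linarith)

/-- The sharp certificate over any larger working region (the continuation principle,
`ReachCertificate.enlarge`). [cite: Tao2016AveragedNS, §5.5 Theorem 5.3] -/
def taoReachSharp_enlarge {ρ εd : ℝ} (hρ : 0 ≤ ρ) (hεd : 0 ≤ εd)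
    (hB : ρ + εd * 2 < 3133 / 2500 * (ε ^ 2 * exp (-M)) / Real.sqrt M) {U' : Set (Fin 5 → ℝ)}
    (hU' : ball (0 : Fin 5 → ℝ) 2 ⊆ U') :
    ReachCertificate (delayCircuitWith K M ε) U' εd 2 (closedBall delayInit ρ) (firedSet K 6 4) :=
  (taoReachSharp hK hML hMK hε hεle hρ hεd hB).enlarge isOpen_ball hU'

/-- The sharp certificate into bp3's output class `firedOut 6 K 0` (efficiency loss `θ = 0`,
constant `C = 6`; `taoGateWith` has `C = 200`, `θ > 0`). [cite: Tao2016AveragedNS, §5.5 Theorem 5.3] -/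
def taoReachSharp_firedOut {ρ εd : ℝ} (hρ : 0 ≤ ρ) (hεd : 0 ≤ εd)
    (hB : ρ + εd * 2 < 3133 / 2500 * (ε ^ 2 * exp (-M)) / Real.sqrt M) :
    ReachCertificate (delayCircuitWith K M ε) (ball (0 : Fin 5 → ℝ) 2) εd 2
      (closedBall delayInit ρ) (firedOut 6 K 0) :=
  (taoReachSharp hK hML hMK hε hεle hρ hεd hB).monoOut
    (by
      have hK1 : (1 : ℝ) ≤ K := by linarith [(negKick_params hK hML hMK hε hεle).1]
      have h := firedSet_subset_firedOut (e := 6) (m := 4) hK1 (by norm_num)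
      rwa [show max (6 : ℝ) 4 = 6 by norm_num] at h)

end Standing

/-! ## §5. Necessity: no reach certificate beyond the dud level -/

section Necessity

variable {K M ε : ℝ} (hK : 2 * 20 ^ 42 * (Nat.factorial 42 : ℝ) + 16 ≤ K)
  (hML : 3000 * Real.log K ≤ M) (hMK : M ≤ K ^ 10) (hε : 0 < ε)
  (hεle : ε ≤ exp (-(10 * M)) / K ^ 100)
include hK hML hMK hε hεle

/-- **The obstruction is ONE explicit datum — a NEGATIVE pre-load of the trigger mode.** For every
member under the standing hypotheses, EVERY open working region `U`, defect level `εd ≥ 0`, cycle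
time `0 ≤ τc ≤ 2`, input class `Ain` containing the negative-kick segment
`{kickInit (-κ) : 1.2532·ε²e^{-M}/√M < κ < 1.2535·ε²e^{-M}/√M}` (energy-normalised data with the
trigger mode `c` pre-loaded AGAINST the seed), and output class `Aout ⊆ {ã > 6e^{-M}}`: the
interface `ReachCertificate (delayCircuitWith K M ε) U εd τc Ain Aout` is EMPTY. The pinned
negative-kick dud (NegativeKickThreshold.lean) lies on that segment, is an exact trajectory (defect
`0 ≤ εd`) and keeps `|ã| ≤ 6e^{-M}` on `[0, 2]`; by the interface's continuation principle
(`ReachCertificate.reach`) a certificate would make it visit `Aout` by time `τc`. DESIGN REMARK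
(what is NOT obstructed): input classes that exclude negative `c`-pre-loads above the seed scale are
not covered — a POSITIVE pre-load fires the gate EARLY (TriggerFragility.lean,
`not_hasAbruptTransition_of_kick`: it defeats the TIMING of Theorem 5.3, not the reach of a fired
state), so the two-sided threshold of this file is a statement about BALLS around `delayInit`.
[cite: Tao2016AveragedNS, §5.5 Theorem 5.3] -/
theorem isEmpty_reachCertificate_of_negKick {U : Set (Fin 5 → ℝ)} (hU : IsOpen U) {εd τc : ℝ}
    (hεd : 0 ≤ εd) (hτ0 : 0 ≤ τc) (hτ2 : τc ≤ 2) {Ain Aout : Set (Fin 5 → ℝ)}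
    (hAin : ∀ κ : ℝ, 3133 / 2500 * (ε ^ 2 * exp (-M)) / Real.sqrt M < κ →
      κ < 2507 / 2000 * (ε ^ 2 * exp (-M)) / Real.sqrt M → kickInit (-κ) ∈ Ain)
    (hAout : ∀ p ∈ Aout, 6 * exp (-M) < p 4) :
    IsEmpty (ReachCertificate (delayCircuitWith K M ε) U εd τc Ain Aout) := by
  refine ⟨fun C => ?_⟩
  obtain ⟨κ, hκ1, hκ2, -, hdud⟩ := exists_negativeKick_dud_pinned hK hML hMK hε hεle
  set x : ℝ → Fin 5 → ℝ := fun t => delayFlowWith K M ε t (kickInit (-κ)) with hxdef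
  have hq : kickInit (-κ) ∈ Ain := hAin κ hκ1 hκ2
  have hx0 : x 0 = kickInit (-κ) := delayFlowWith_zero K M ε _
  have hder : ∀ t, HasDerivAt x (delayCircuitWith K M ε (x t)) t := fun t =>
    hasDerivAt_delayFlowWith K M ε _ t
  have hcont : ContinuousOn x (Icc 0 τc) := fun t _ => (hder t).continuousAt.continuousWithinAt
  have hW : ∀ σ ∈ Ico 0 τc, ∃ W : Fin 5 → ℝ,
      HasDerivWithinAt x W (Ici σ) σ ∧ ‖W - delayCircuitWith K M ε (x σ)‖ ≤ εd :=
    fun σ _ => ⟨_, (hder σ).hasDerivWithinAt, by simpa using hεd⟩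
  obtain ⟨σ, hσ, hA⟩ := C.reach hU hq hτ0 hx0 hcont hW
  have h1 := hAout _ hA
  have h3 := (abs_le.1 (hdud σ ⟨hσ.1, hσ.2.trans hτ2⟩).2.2.2).2
  exact absurd h1 (not_lt.2 h3)

/-- **No reach certificate beyond the dud level.** For every member under the standing
hypotheses, EVERY open working region `U`, defect level `εd ≥ 0`, cycle time `0 ≤ τc ≤ 2`, input
class `Ain ⊇ closedBall delayInit ρ` with `ρ ≥ 1.2535·ε²e^{-M}/√M`, and output class
`Aout ⊆ {ã > 6e^{-M}}`: the interface `ReachCertificate (delayCircuitWith K M ε) U εd τc Ain Aout` is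
EMPTY — the ball contains the negative-kick segment of `isEmpty_reachCertificate_of_negKick`
(`‖kickInit (-κ) - delayInit‖ ≤ κ`). [cite: Tao2016AveragedNS, §5.5 Theorem 5.3] -/
theorem isEmpty_reachCertificate_of_ge {U : Set (Fin 5 → ℝ)} (hU : IsOpen U) {εd τc ρ : ℝ}
    (hεd : 0 ≤ εd) (hτ0 : 0 ≤ τc) (hτ2 : τc ≤ 2) {Ain Aout : Set (Fin 5 → ℝ)}
    (hAin : closedBall delayInit ρ ⊆ Ain)
    (hρ : 2507 / 2000 * (ε ^ 2 * exp (-M)) / Real.sqrt M ≤ ρ)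
    (hAout : ∀ p ∈ Aout, 6 * exp (-M) < p 4) :
    IsEmpty (ReachCertificate (delayCircuitWith K M ε) U εd τc Ain Aout) := by
  obtain ⟨-, hM4, -, -, -, -⟩ := negKick_params hK hML hMK hε hεle
  obtain ⟨-, h2⟩ := dud_level_le hK hML hMK hε hεle
  have hsq0 : 0 < Real.sqrt M := Real.sqrt_pos.2 (by linarith)
  have hL0 : 0 < 3133 / 2500 * (ε ^ 2 * exp (-M)) / Real.sqrt M := by positivity
  refine isEmpty_reachCertificate_of_negKick hK hML hMK hε hεle hU hεd hτ0 hτ2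
    (fun κ hκ1 hκ2 => hAin ?_) hAout
  have hκ0 : 0 < κ := hL0.trans hκ1
  have hκle : κ ≤ 1 := by linarith
  rw [mem_closedBall, dist_eq_norm]
  exact (norm_kickInit_neg_sub_delayInit hκ0.le hκle).trans (hκ2.le.trans hρ)

/-- **No reach certificate into a fired set beyond the dud level** (tolerance `e ≤ K²⁰/2`; any
`m`, `U`, `εd ≥ 0`, `τc ≤ 2`, `Ain ⊇ closedBall delayInit ρ`, `ρ ≥ 1.2535·ε²e^{-M}/√M`).
[cite: Tao2016AveragedNS, §5.5 Theorem 5.3] -/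
theorem isEmpty_reachCertificate_firedSet {U : Set (Fin 5 → ℝ)} (hU : IsOpen U) {εd τc ρ : ℝ}
    (hεd : 0 ≤ εd) (hτ0 : 0 ≤ τc) (hτ2 : τc ≤ 2) {Ain : Set (Fin 5 → ℝ)}
    (hAin : closedBall delayInit ρ ⊆ Ain)
    (hρ : 2507 / 2000 * (ε ^ 2 * exp (-M)) / Real.sqrt M ≤ ρ) {e m : ℝ} (he : e ≤ K ^ 20 / 2) :
    IsEmpty (ReachCertificate (delayCircuitWith K M ε) U εd τc Ain (firedSet K e m)) := by
  obtain ⟨hK16, -, -, -, -, hexpM⟩ := negKick_params hK hML hMK hε hεle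
  refine isEmpty_reachCertificate_of_ge hK hML hMK hε hεle hU hεd hτ0 hτ2 hAin hρ fun p hp => ?_
  have h := firedSet_subset_half (by linarith) he hp
  change 1 / 2 ≤ p 4 at h
  linarith

/-- **No reach certificate into bp3's output class `firedOut C K θ` beyond the dud level**
(`C/K¹⁰ + θ ≤ 1/2`). [cite: Tao2016AveragedNS, §5.5 Theorem 5.3] -/
theorem isEmpty_reachCertificate_firedOut {U : Set (Fin 5 → ℝ)} (hU : IsOpen U) {εd τc ρ : ℝ}
    (hεd : 0 ≤ εd) (hτ0 : 0 ≤ τc) (hτ2 : τc ≤ 2) {Ain : Set (Fin 5 → ℝ)}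
    (hAin : closedBall delayInit ρ ⊆ Ain)
    (hρ : 2507 / 2000 * (ε ^ 2 * exp (-M)) / Real.sqrt M ≤ ρ) {C θ : ℝ}
    (hCθ : C / K ^ 10 + θ ≤ 1 / 2) :
    IsEmpty (ReachCertificate (delayCircuitWith K M ε) U εd τc Ain (firedOut C K θ)) := by
  obtain ⟨-, -, -, -, -, hexpM⟩ := negKick_params hK hML hMK hε hεle
  refine isEmpty_reachCertificate_of_ge hK hML hMK hε hεle hU hεd hτ0 hτ2 hAin hρ fun p hp => ?_
  have h := (mem_firedOut_iff.1 hp).1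
  linarith

/-- In particular the sharp certificates of §4 cannot be pushed to input radius
`1.2535·ε²e^{-M}/√M`: with `U` = the open sup-ball of radius `2`, `τc = 2`, `Ain = closedBall
delayInit ρ`, `Aout = firedSet K 6 4`. [cite: Tao2016AveragedNS, §5.5 Theorem 5.3] -/
theorem isEmpty_taoReach_of_ge {εd ρ : ℝ} (hεd : 0 ≤ εd)
    (hρ : 2507 / 2000 * (ε ^ 2 * exp (-M)) / Real.sqrt M ≤ ρ) :
    IsEmpty (ReachCertificate (delayCircuitWith K M ε) (ball (0 : Fin 5 → ℝ) 2) εd 2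
      (closedBall delayInit ρ) (firedSet K 6 4)) := by
  have hK20 : (6 : ℝ) ≤ K ^ 20 / 2 := by
    have hK16 := (negKick_params hK hML hMK hε hεle).1
    have : (16 : ℝ) ≤ K ^ 20 := by
      calc (16 : ℝ) ≤ K := hK16
        _ = K ^ 1 := (pow_one K).symm
        _ ≤ K ^ 20 := pow_le_pow_right₀ (by linarith) (by norm_num)
    linarith
  exact isEmpty_reachCertificate_firedSet hK hML hMK hε hεle isOpen_ball hεd (by norm_num) le_rfl
    Subset.rfl hρ hK20

end Necessity

/-! ## §5b. The defect axis: the seed adversary in the interface (no standing hypotheses)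

The pre-load axis (§5) is closed from above by the negative-kick dud; the DEFECT axis is closed by
the seed adversary of GateFragility.lean / SeedCancellation.lean: the free pump orbit
`seedFreeOrbit ε = (sech εt, tanh εt, 0, 0, 0)` starts AT Tao's datum (5.6), has defect exactly
`-ε²e^{-M}a²·e_c` against the member `delayCircuitWith K M ε` (`norm_seedFreeOrbit_defectWith_le`:
sup-size `≤ ε²e^{-M}`) and keeps `c = d = ã = 0` for ALL time. In the interface this reads: at
defect levels `εd ≥ ε²e^{-M}` — the member's SEED RATE `s` — NO reach certificate exists, for ANY
open working region, ANY cycle time `τc ≥ 0` (not only `τc ≤ 2`: the adversary never fires), ANY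
input class containing (5.6) itself and ANY output class missing `{ã = 0}`; nothing about `K`, `M`,
`ε` is needed. On the defect axis the two sides of this file are NOT matched: certified for
`2εd < 1.2532·u` (§4, `u = s/√M`), impossible from `εd ≥ s = u√M` — a factor `≥ 1.59√M` apart
(`√M ≥ 77` under the standing hypotheses). Which side is lossy is not decided here; the linearised
trigger equation (forcing weighted by the ignition window of width `≍ 1/√M`) suggests the seed
adversary is the sharp one and the weight `2` of `εd` in §3–§4 is the loss. -/

/-- **No reach certificate at defect level at or above the seed rate `ε²e^{-M}`** — any member
`delayCircuitWith K M ε` (no hypothesis on `K`, `M`, `ε`), any open `U`, any cycle time `τc ≥ 0`,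
any input class `Ain ∋ delayInit`, any output class `Aout ⊆ {ã ≠ 0}`: the seed-free orbit is an
admissible curve from (5.6) (defect `≤ ε²e^{-M} ≤ εd`) with `ã ≡ 0`, while the interface's
continuation principle `ReachCertificate.reach` would make it visit `Aout`.
[cite: Tao2016AveragedNS, §5.5 (5.5)–(5.6)] -/
theorem isEmpty_reachCertificate_of_seed_le {K M ε : ℝ} {U : Set (Fin 5 → ℝ)} (hU : IsOpen U)
    {εd τc : ℝ} (hεd : ε ^ 2 * exp (-M) ≤ εd) (hτ0 : 0 ≤ τc) {Ain Aout : Set (Fin 5 → ℝ)}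
    (hAin : delayInit ∈ Ain) (hAout : ∀ p ∈ Aout, p 4 ≠ 0) :
    IsEmpty (ReachCertificate (delayCircuitWith K M ε) U εd τc Ain Aout) := by
  refine ⟨fun C => ?_⟩
  have hx0 : seedFreeOrbit ε 0 = delayInit := seedFreeOrbit_zero ε
  have hcont : ContinuousOn (seedFreeOrbit ε) (Icc 0 τc) := fun t _ =>
    (hasDerivAt_seedFreeOrbit ε t).continuousAt.continuousWithinAt
  have hW : ∀ σ ∈ Ico 0 τc, ∃ W : Fin 5 → ℝ, HasDerivWithinAt (seedFreeOrbit ε) W (Ici σ) σ ∧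
      ‖W - delayCircuitWith K M ε (seedFreeOrbit ε σ)‖ ≤ εd := fun σ _ =>
    ⟨_, (hasDerivAt_seedFreeOrbit ε σ).hasDerivWithinAt,
      (norm_seedFreeOrbit_defectWith_le K M ε σ).trans hεd⟩
  obtain ⟨σ, -, hA⟩ := C.reach hU hAin hτ0 hx0 hcont hW
  exact hAout _ hA (seedFreeOrbit_output ε σ)

/-- … into a fired set `firedSet K e m` with `e < K²⁰` (`K > 0`; then `ã > 0` on it; any `m`),
from any input class containing (5.6), at any cycle time `τc ≥ 0`.
[cite: Tao2016AveragedNS, §5.5 Theorem 5.3] -/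
theorem isEmpty_reachCertificate_firedSet_of_seed_le {K M ε : ℝ} (hK : 0 < K) {U : Set (Fin 5 → ℝ)}
    (hU : IsOpen U) {εd τc : ℝ} (hεd : ε ^ 2 * exp (-M) ≤ εd) (hτ0 : 0 ≤ τc)
    {Ain : Set (Fin 5 → ℝ)} (hAin : delayInit ∈ Ain) {e m : ℝ} (he : e < K ^ 20) :
    IsEmpty (ReachCertificate (delayCircuitWith K M ε) U εd τc Ain (firedSet K e m)) := by
  refine isEmpty_reachCertificate_of_seed_le hU hεd hτ0 hAin fun p hp h0 => ?_
  have h1 := (mem_firedSet_iff.1 hp).1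
  rw [h0] at h1
  have h2 : e / K ^ 20 < 1 := (div_lt_one (pow_pos hK 20)).2 he
  norm_num at h1
  linarith

/-- … into bp3's output class `firedOut C K θ` with `C/K¹⁰ + θ < 1` (then `ã > 0` on it), from any
input class containing (5.6), at any cycle time `τc ≥ 0`. [cite: Tao2016AveragedNS, §5.5 Theorem 5.3] -/
theorem isEmpty_reachCertificate_firedOut_of_seed_le {K M ε : ℝ} {U : Set (Fin 5 → ℝ)}
    (hU : IsOpen U) {εd τc : ℝ} (hεd : ε ^ 2 * exp (-M) ≤ εd) (hτ0 : 0 ≤ τc)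
    {Ain : Set (Fin 5 → ℝ)} (hAin : delayInit ∈ Ain) {C θ : ℝ} (hCθ : C / K ^ 10 + θ < 1) :
    IsEmpty (ReachCertificate (delayCircuitWith K M ε) U εd τc Ain (firedOut C K θ)) := by
  refine isEmpty_reachCertificate_of_seed_le hU hεd hτ0 hAin fun p hp h0 => ?_
  have h1 := (mem_firedOut_iff.1 hp).1
  rw [h0] at h1
  linarith

/-- In particular, for the classes of §4 (`U` = the open sup-ball of radius `2`,
`Ain = closedBall delayInit ρ` with `ρ ≥ 0`, `Aout = firedSet K 6 4`, `K ≥ 2`): NO reach certificate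
at ANY cycle time once `εd ≥ ε²e^{-M}` — whatever the input radius.
[cite: Tao2016AveragedNS, §5.5 Theorem 5.3] -/
theorem isEmpty_taoReach_of_seed_le {K M ε ρ εd τc : ℝ} (hK : 2 ≤ K) (hρ : 0 ≤ ρ)
    (hεd : ε ^ 2 * exp (-M) ≤ εd) (hτ0 : 0 ≤ τc) :
    IsEmpty (ReachCertificate (delayCircuitWith K M ε) (ball (0 : Fin 5 → ℝ) 2) εd τc
      (closedBall delayInit ρ) (firedSet K 6 4)) := by
  have h20 : (2 : ℝ) ^ 20 ≤ K ^ 20 := pow_le_pow_left₀ (by norm_num) hK 20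
  exact isEmpty_reachCertificate_firedSet_of_seed_le (by linarith) isOpen_ball hεd hτ0
    (mem_closedBall_self hρ) (by norm_num at h20 ⊢; linarith)

/-! ## §6. Tunings: Tao's `M = K¹⁰` and the log-retuned members `M = p log K` -/

/-- **Tao's own gate (5.5)** (`M = K¹⁰`, `√M = K⁵`; the side condition `3000 log K ≤ K¹⁰` is
automatic): a reach certificate from `closedBall delayInit ρ` with defect `εd` into the fired set
of Theorem 5.3 whenever `ρ + 2εd < 1.2532·ε²e^{-K¹⁰}/K⁵`, for every `K ≥ 2·20⁴²·42! + 16` and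
`0 < ε ≤ e^{-10K¹⁰}K^{-100}`. [cite: Tao2016AveragedNS, §5.5 Theorem 5.3] -/
def taoReach {K ε ρ εd : ℝ} (hK : 2 * 20 ^ 42 * (Nat.factorial 42 : ℝ) + 16 ≤ K) (hε : 0 < ε)
    (hεle : ε ≤ exp (-(10 * K ^ 10)) / K ^ 100) (hρ : 0 ≤ ρ) (hεd : 0 ≤ εd)
    (hB : ρ + εd * 2 < 3133 / 2500 * (ε ^ 2 * exp (-K ^ 10)) / K ^ 5) :
    ReachCertificate (delayCircuit K ε) (ball (0 : Fin 5 → ℝ) 2) εd 2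
      (closedBall delayInit ρ) (firedSet K 6 4) := by
  have hK0 : (0 : ℝ) ≤ K := by
    have : (0 : ℝ) ≤ 2 * 20 ^ 42 * (Nat.factorial 42 : ℝ) := by positivity
    linarith
  have hsq : Real.sqrt (K ^ 10) = K ^ 5 := by
    rw [show (K ^ 10 : ℝ) = (K ^ 5) ^ 2 by ring, Real.sqrt_sq (by positivity)]
  have hB' : ρ + εd * 2 < 3133 / 2500 * (ε ^ 2 * exp (-K ^ 10)) / Real.sqrt (K ^ 10) := by
    rwa [hsq]
  have h := taoReachSharp hK (log_le_pow_ten_of_K hK) le_rfl hε hεle hρ hεd hB'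
  rwa [delayCircuitWith_pow_ten] at h

/-- … and NO reach certificate for Tao's gate (5.5) from input radius
`ρ ≥ 1.2535·ε²e^{-K¹⁰}/K⁵` (any defect level `εd ≥ 0`; `U` = the open sup-ball of radius `2`,
`τc = 2`, `Aout = firedSet K 6 4`). [cite: Tao2016AveragedNS, §5.5 Theorem 5.3] -/
theorem isEmpty_taoReach_of_ge_pow_ten {K ε ρ εd : ℝ}
    (hK : 2 * 20 ^ 42 * (Nat.factorial 42 : ℝ) + 16 ≤ K) (hε : 0 < ε)
    (hεle : ε ≤ exp (-(10 * K ^ 10)) / K ^ 100) (hεd : 0 ≤ εd)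
    (hρ : 2507 / 2000 * (ε ^ 2 * exp (-K ^ 10)) / K ^ 5 ≤ ρ) :
    IsEmpty (ReachCertificate (delayCircuit K ε) (ball (0 : Fin 5 → ℝ) 2) εd 2
      (closedBall delayInit ρ) (firedSet K 6 4)) := by
  have hK0 : (0 : ℝ) ≤ K := by
    have : (0 : ℝ) ≤ 2 * 20 ^ 42 * (Nat.factorial 42 : ℝ) := by positivity
    linarith
  have hsq : Real.sqrt (K ^ 10) = K ^ 5 := by
    rw [show (K ^ 10 : ℝ) = (K ^ 5) ^ 2 by ring, Real.sqrt_sq (by positivity)]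
  have hρ' : 2507 / 2000 * (ε ^ 2 * exp (-K ^ 10)) / Real.sqrt (K ^ 10) ≤ ρ := by rwa [hsq]
  have h := isEmpty_taoReach_of_ge hK (log_le_pow_ten_of_K hK) le_rfl hε hεle hεd hρ'
  rwa [delayCircuitWith_pow_ten] at h

/-- **The log-retuned members** `M = p log K` (`p ≥ 3000`, `p log K ≤ K¹⁰`,
`0 < ε ≤ K^{-10p-100}` in the form `e^{-10M}K^{-100}`; `e^{-M} = K^{-p}`): a reach certificate from
`closedBall delayInit ρ` with defect `εd` into the fired set of Theorem 5.3 whenever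
`ρ + 2εd < 1.2532·ε²/(K^p·√(p log K))` — a POLYNOMIAL budget in `K`.
[cite: Tao2016AveragedNS, §5.5 Theorem 5.3] -/
def taoReachLog {K ε ρ εd : ℝ} {p : ℕ} (hK : 2 * 20 ^ 42 * (Nat.factorial 42 : ℝ) + 16 ≤ K)
    (hp : (3000 : ℝ) ≤ p) (hpK : (p : ℝ) * Real.log K ≤ K ^ 10) (hε : 0 < ε)
    (hεle : ε ≤ exp (-(10 * ((p : ℝ) * Real.log K))) / K ^ 100) (hρ : 0 ≤ ρ) (hεd : 0 ≤ εd)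
    (hB : ρ + εd * 2 < 3133 / 2500 * ε ^ 2 / (K ^ p * Real.sqrt (p * Real.log K))) :
    ReachCertificate (delayCircuitWith K (p * Real.log K) ε) (ball (0 : Fin 5 → ℝ) 2) εd 2
      (closedBall delayInit ρ) (firedSet K 6 4) := by
  have hB0 : (0 : ℝ) ≤ 2 * 20 ^ 42 * (Nat.factorial 42 : ℝ) := by positivity
  have hK1 : (1 : ℝ) ≤ K := by linarith
  have hK0 : (0 : ℝ) < K := by linarith
  have hML : 3000 * Real.log K ≤ (p : ℝ) * Real.log K :=
    mul_le_mul_of_nonneg_right hp (Real.log_nonneg hK1)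
  have e1 : 3133 / 2500 * ε ^ 2 / (K ^ p * Real.sqrt (p * Real.log K)) =
      3133 / 2500 * (ε ^ 2 * exp (-((p : ℝ) * Real.log K))) / Real.sqrt (p * Real.log K) := by
    rw [exp_neg_natMul_log hK0 p]; ring
  rw [e1] at hB
  exact taoReachSharp hK hML hpK hε hεle hρ hεd hB

/-- In particular the polynomial budget `ρ + 2εd ≤ ε²/K^{p+5}` is certified on the log-retuned
member `M = p log K` (`firesUnderBudget_log`, CriticalBudget.lean — the honest positive form of the
cell's question (D)(4), now in the reach interface). [cite: Tao2016AveragedNS, §5.5 Theorem 5.3] -/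
def taoReachLogPow {K ε ρ εd : ℝ} {p : ℕ} (hK : 2 * 20 ^ 42 * (Nat.factorial 42 : ℝ) + 16 ≤ K)
    (hp : (3000 : ℝ) ≤ p) (hpK : (p : ℝ) * Real.log K ≤ K ^ 10) (hε : 0 < ε)
    (hεle : ε ≤ exp (-(10 * ((p : ℝ) * Real.log K))) / K ^ 100) (hρ : 0 ≤ ρ) (hεd : 0 ≤ εd)
    (hB : ρ + εd * 2 ≤ ε ^ 2 / K ^ (p + 5)) :
    ReachCertificate (delayCircuitWith K (p * Real.log K) ε) (ball (0 : Fin 5 → ℝ) 2) εd 2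
      (closedBall delayInit ρ) (firedSet K 6 4) := by
  have hB0 : (0 : ℝ) ≤ 2 * 20 ^ 42 * (Nat.factorial 42 : ℝ) := by positivity
  have hK1 : (1 : ℝ) ≤ K := by linarith
  have hML : 3000 * Real.log K ≤ (p : ℝ) * Real.log K :=
    mul_le_mul_of_nonneg_right hp (Real.log_nonneg hK1)
  obtain ⟨-, -, hε2, -⟩ := Ignition.ignition_params hK hML hpK hε hεle
  have hle : ε ^ 2 / K ^ (p + 5) ≤ ε ^ 2 := div_le_self (sq_nonneg ε) (one_le_pow₀ hK1)
  exact reachCertificateOfFires (firesUnderBudget_log hK hp hpK hε hεle (by norm_num) (by norm_num))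
    hεd hB (by linarith)

/-- … and NO reach certificate on the log-retuned member from input radius
`ρ ≥ 1.2535·ε²/(K^p·√(p log K))` (any `εd ≥ 0`; `U` = the open sup-ball of radius `2`, `τc = 2`,
`Aout = firedSet K 6 4`). [cite: Tao2016AveragedNS, §5.5 Theorem 5.3] -/
theorem isEmpty_taoReachLog_of_ge {K ε ρ εd : ℝ} {p : ℕ}
    (hK : 2 * 20 ^ 42 * (Nat.factorial 42 : ℝ) + 16 ≤ K) (hp : (3000 : ℝ) ≤ p)
    (hpK : (p : ℝ) * Real.log K ≤ K ^ 10) (hε : 0 < ε)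
    (hεle : ε ≤ exp (-(10 * ((p : ℝ) * Real.log K))) / K ^ 100) (hεd : 0 ≤ εd)
    (hρ : 2507 / 2000 * ε ^ 2 / (K ^ p * Real.sqrt (p * Real.log K)) ≤ ρ) :
    IsEmpty (ReachCertificate (delayCircuitWith K (p * Real.log K) ε) (ball (0 : Fin 5 → ℝ) 2)
      εd 2 (closedBall delayInit ρ) (firedSet K 6 4)) := by
  have hB0 : (0 : ℝ) ≤ 2 * 20 ^ 42 * (Nat.factorial 42 : ℝ) := by positivity
  have hK1 : (1 : ℝ) ≤ K := by linarith
  have hK0 : (0 : ℝ) < K := by linarith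
  have hML : 3000 * Real.log K ≤ (p : ℝ) * Real.log K :=
    mul_le_mul_of_nonneg_right hp (Real.log_nonneg hK1)
  have e1 : 2507 / 2000 * ε ^ 2 / (K ^ p * Real.sqrt (p * Real.log K)) =
      2507 / 2000 * (ε ^ 2 * exp (-((p : ℝ) * Real.log K))) / Real.sqrt (p * Real.log K) := by
    rw [exp_neg_natMul_log hK0 p]; ring
  rw [e1] at hρ
  exact isEmpty_taoReach_of_ge hK hML hpK hε hεle hεd hρ

/-- **Tao's own gate (5.5)**: no reach certificate at any cycle time once the defect level reaches
the seed rate `ε²e^{-K¹⁰}` (any `K ≥ 2`, any `ε`, any input radius `ρ ≥ 0`).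
[cite: Tao2016AveragedNS, §5.5 (5.5)–(5.6)] -/
theorem isEmpty_taoReach_of_seed_le_pow_ten {K ε ρ εd τc : ℝ} (hK : 2 ≤ K) (hρ : 0 ≤ ρ)
    (hεd : ε ^ 2 * exp (-K ^ 10) ≤ εd) (hτ0 : 0 ≤ τc) :
    IsEmpty (ReachCertificate (delayCircuit K ε) (ball (0 : Fin 5 → ℝ) 2) εd τc
      (closedBall delayInit ρ) (firedSet K 6 4)) := by
  rw [← delayCircuitWith_pow_ten]
  exact isEmpty_taoReach_of_seed_le hK hρ hεd hτ0

/-- **Log-retuned members** `M = p log K`: no reach certificate at any cycle time once the defect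
level reaches the POLYNOMIAL seed rate `ε²/K^p` (any `K ≥ 2`, any `ε`, any `ρ ≥ 0`) — the
interface form of SeedCancellation.lean's answer to the cell's question (D)(4).
[cite: Tao2016AveragedNS, §5.5 (5.5)–(5.6)] -/
theorem isEmpty_taoReachLog_of_seed_le {K ε ρ εd τc : ℝ} {p : ℕ} (hK : 2 ≤ K) (hρ : 0 ≤ ρ)
    (hεd : ε ^ 2 / K ^ p ≤ εd) (hτ0 : 0 ≤ τc) :
    IsEmpty (ReachCertificate (delayCircuitWith K (p * Real.log K) ε) (ball (0 : Fin 5 → ℝ) 2)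
      εd τc (closedBall delayInit ρ) (firedSet K 6 4)) := by
  have hK0 : (0 : ℝ) < K := by linarith
  have e1 : ε ^ 2 * exp (-((p : ℝ) * Real.log K)) = ε ^ 2 / K ^ p := by
    rw [exp_neg_natMul_log hK0 p, div_eq_mul_inv]
  exact isEmpty_taoReach_of_seed_le hK hρ (by rwa [e1]) hτ0

/-! ## §7. The certifiable input radius as one number -/

/-- **The certifiable radius** at defect level `εd`: the supremum of the input radii `ρ` for which
the reach interface over the open sup-ball of radius `2`, cycle time `2`, from
`closedBall delayInit ρ` into the fired set of Theorem 5.3 is inhabited.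
[cite: Tao2016AveragedNS, §5.5 Theorem 5.3] -/
def reachRadius (K M ε εd : ℝ) : ℝ :=
  sSup {ρ : ℝ | Nonempty (ReachCertificate (delayCircuitWith K M ε) (ball (0 : Fin 5 → ℝ) 2) εd 2
    (closedBall delayInit ρ) (firedSet K 6 4))}

/-- Certifiability is downward closed in the input radius (`ReachCertificate.monoIn`). [folklore] -/
theorem nonempty_reachCertificate_anti {K M ε εd ρ ρ' : ℝ} (h : ρ' ≤ ρ)
    (hne : Nonempty (ReachCertificate (delayCircuitWith K M ε) (ball (0 : Fin 5 → ℝ) 2) εd 2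
      (closedBall delayInit ρ) (firedSet K 6 4))) :
    Nonempty (ReachCertificate (delayCircuitWith K M ε) (ball (0 : Fin 5 → ℝ) 2) εd 2
      (closedBall delayInit ρ') (firedSet K 6 4)) :=
  ⟨hne.some.monoIn (closedBall_subset_closedBall h)⟩

/-- The VACUOUS certificate from an empty input class (bookkeeping for `reachRadius`: every
negative radius is "certified"). [folklore] -/
def reachCertificateVacuous {F : (Fin 5 → ℝ) → Fin 5 → ℝ} {U : Set (Fin 5 → ℝ)} {εd τc : ℝ}
    {Ain Aout : Set (Fin 5 → ℝ)} (h : ∀ p, p ∉ Ain) : ReachCertificate F U εd τc Ain Aout where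
  Tube _ _ := ∅
  Tube_closed p hp := (h p hp).elim
  Tube_zero p hp := (h p hp).elim
  Tube_sub p hp := (h p hp).elim
  cert p hp := (h p hp).elim

/-- **At defect level at or above the seed rate the certifiable radius collapses**: for
`εd ≥ ε²e^{-M}` (any member with `K ≥ 2`) the certified radii are exactly the negative (vacuous)
ones, so `reachRadius K M ε εd = 0` — and `ρ = 0` itself is NOT certified
(`isEmpty_taoReach_of_seed_le`). [cite: Tao2016AveragedNS, §5.5 (5.5)–(5.6)] -/
theorem reachRadius_eq_zero_of_seed_le {K M ε εd : ℝ} (hK : 2 ≤ K) (hεd : ε ^ 2 * exp (-M) ≤ εd) :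
    reachRadius K M ε εd = 0 := by
  have hS : {ρ : ℝ | Nonempty (ReachCertificate (delayCircuitWith K M ε) (ball (0 : Fin 5 → ℝ) 2)
      εd 2 (closedBall delayInit ρ) (firedSet K 6 4))} = Iio 0 := by
    ext ρ
    simp only [mem_setOf_eq, mem_Iio]
    refine ⟨fun h => ?_, fun hρ => ⟨reachCertificateVacuous fun p hp => ?_⟩⟩
    · by_contra hρ
      exact (isEmpty_taoReach_of_seed_le hK (not_lt.1 hρ) hεd (by norm_num)).false h.some
    · rw [closedBall_eq_empty.2 hρ] at hp
      exact hp
  rw [reachRadius, hS]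
  exact csSup_Iio

section Radius

variable {K M ε : ℝ} (hK : 2 * 20 ^ 42 * (Nat.factorial 42 : ℝ) + 16 ≤ K)
  (hML : 3000 * Real.log K ≤ M) (hMK : M ≤ K ^ 10) (hε : 0 < ε)
  (hεle : ε ≤ exp (-(10 * M)) / K ^ 100)
include hK hML hMK hε hεle

/-- **Bracket for the certifiable radius**: for `0 ≤ εd` with `2εd < 1.2532·u`,
`1.2532·u - 2εd ≤ reachRadius K M ε εd ≤ 1.2535·u` (`u = ε²e^{-M}/√M`).
[cite: Tao2016AveragedNS, §5.5 Theorem 5.3] -/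
theorem reachRadius_mem_Icc {εd : ℝ} (hεd : 0 ≤ εd)
    (h2 : εd * 2 < 3133 / 2500 * (ε ^ 2 * exp (-M)) / Real.sqrt M) :
    reachRadius K M ε εd ∈
      Icc (3133 / 2500 * (ε ^ 2 * exp (-M)) / Real.sqrt M - εd * 2)
        (2507 / 2000 * (ε ^ 2 * exp (-M)) / Real.sqrt M) := by
  set S : Set ℝ := {ρ : ℝ | Nonempty (ReachCertificate (delayCircuitWith K M ε)
    (ball (0 : Fin 5 → ℝ) 2) εd 2 (closedBall delayInit ρ) (firedSet K 6 4))} with hS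
  have hup : ∀ ρ ∈ S, ρ ≤ 2507 / 2000 * (ε ^ 2 * exp (-M)) / Real.sqrt M := fun ρ hρ => by
    by_contra hlt
    exact (isEmpty_taoReach_of_ge hK hML hMK hε hεle hεd (not_le.1 hlt).le).false hρ.some
  have hbdd : BddAbove S := ⟨_, hup⟩
  have hlow : ∀ ρ, 0 ≤ ρ → ρ + εd * 2 < 3133 / 2500 * (ε ^ 2 * exp (-M)) / Real.sqrt M → ρ ∈ S :=
    fun ρ hρ hB => ⟨taoReachSharp hK hML hMK hε hεle hρ hεd hB⟩
  have h0S : (0 : ℝ) ∈ S := hlow 0 le_rfl (by linarith)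
  have hne : S.Nonempty := ⟨0, h0S⟩
  refine ⟨?_, csSup_le hne hup⟩
  -- every ρ < L := 1.2532u - 2εd with ρ ≥ 0 is in S, so L ≤ sSup S
  by_contra hlt
  rw [not_le] at hlt
  change sSup S < _ at hlt
  have h0le : 0 ≤ sSup S := le_csSup hbdd h0S
  obtain ⟨ρ, hρ1, hρ2⟩ := exists_between hlt
  have hρS : ρ ∈ S := hlow ρ (h0le.trans hρ1.le) (by linarith)
  exact absurd (le_csSup hbdd hρS) (not_le.2 hρ1)

/-- **The certifiable radius is a threshold**: every `0 ≤ ρ < reachRadius` is certified, no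
`ρ > reachRadius` is. [cite: Tao2016AveragedNS, §5.5 Theorem 5.3] -/
theorem reachRadius_threshold {εd : ℝ} (hεd : 0 ≤ εd)
    (h2 : εd * 2 < 3133 / 2500 * (ε ^ 2 * exp (-M)) / Real.sqrt M) :
    (∀ ρ, ρ < reachRadius K M ε εd → Nonempty (ReachCertificate (delayCircuitWith K M ε)
        (ball (0 : Fin 5 → ℝ) 2) εd 2 (closedBall delayInit ρ) (firedSet K 6 4))) ∧
      ∀ ρ, reachRadius K M ε εd < ρ → IsEmpty (ReachCertificate (delayCircuitWith K M ε)
        (ball (0 : Fin 5 → ℝ) 2) εd 2 (closedBall delayInit ρ) (firedSet K 6 4)) := by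
  set S : Set ℝ := {ρ : ℝ | Nonempty (ReachCertificate (delayCircuitWith K M ε)
    (ball (0 : Fin 5 → ℝ) 2) εd 2 (closedBall delayInit ρ) (firedSet K 6 4))} with hS
  have hup : ∀ ρ ∈ S, ρ ≤ 2507 / 2000 * (ε ^ 2 * exp (-M)) / Real.sqrt M := fun ρ hρ => by
    by_contra hlt
    exact (isEmpty_taoReach_of_ge hK hML hMK hε hεle hεd (not_le.1 hlt).le).false hρ.some
  have hbdd : BddAbove S := ⟨_, hup⟩
  have h0S : (0 : ℝ) ∈ S := ⟨taoReachSharp hK hML hMK hε hεle le_rfl hεd (by linarith)⟩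
  have hne : S.Nonempty := ⟨0, h0S⟩
  refine ⟨fun ρ hρ => ?_, fun ρ hρ => ?_⟩
  · change ρ < sSup S at hρ
    obtain ⟨ρ', hρ'S, hρρ'⟩ := exists_lt_of_lt_csSup hne hρ
    exact nonempty_reachCertificate_anti hρρ'.le hρ'S
  · change sSup S < ρ at hρ
    refine ⟨fun C => ?_⟩
    have hρS : ρ ∈ S := ⟨C⟩
    exact absurd (le_csSup hbdd hρS) (not_le.2 hρ)

/-- **Certifiable radius = critical budget.** At defect level `0` the certifiable input radius of
the reach interface agrees with the critical budget of CriticalBudget.lean (any tolerance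
`6 ≤ e ≤ K²⁰/2`, `4 ≤ m`) to `3·10⁻⁴·ε²e^{-M}/√M`: in the cell's own interface the certifiable
robustness of Tao's gate is `√(π/2)·ε²e^{-M}/√M` to four figures.
[cite: Tao2016AveragedNS, §5.5 Theorem 5.3] -/
theorem reachRadius_sub_criticalBudget {e m : ℝ} (he : 6 ≤ e) (he' : e ≤ K ^ 20 / 2) (hm : 4 ≤ m) :
    |reachRadius K M ε 0 - criticalBudget K M ε e m| ≤
      3 / 10000 * (ε ^ 2 * exp (-M)) / Real.sqrt M := by
  have hL0 : (0 : ℝ) < 3133 / 2500 * (ε ^ 2 * exp (-M)) / Real.sqrt M := by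
    obtain ⟨-, hM4, -, -, -, -⟩ := negKick_params hK hML hMK hε hεle
    have hsq0 : 0 < Real.sqrt M := Real.sqrt_pos.2 (by linarith)
    positivity
  have h1 := reachRadius_mem_Icc hK hML hMK hε hεle le_rfl (by linarith)
  have h2 := criticalBudget_mem_Icc hK hML hMK hε hεle he he' hm
  have hUL : 2507 / 2000 * (ε ^ 2 * exp (-M)) / Real.sqrt M -
      3133 / 2500 * (ε ^ 2 * exp (-M)) / Real.sqrt M =
        3 / 10000 * (ε ^ 2 * exp (-M)) / Real.sqrt M := by ring
  obtain ⟨h1a, h1b⟩ := h1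
  obtain ⟨h2a, h2b⟩ := h2
  rw [abs_le]
  constructor <;> linarith

/-- **The `(ρ, εd)` budget plane for the classes of §4** (`u = ε²e^{-M}/√M`, seed rate
`s = ε²e^{-M} = u√M`): CERTIFIED on the triangle `ρ + 2εd < 1.2532·u`; IMPOSSIBLE on the half-planes
`ρ ≥ 1.2535·u` (pre-load axis, negative-kick dud, cycle time `2`) and `εd ≥ s` (defect axis, seed
adversary, every cycle time); undecided in between (on the defect axis: `0.6266·u ≤ εd < u√M`).
[cite: Tao2016AveragedNS, §5.5 Theorem 5.3] -/
theorem taoReach_phases {ρ εd : ℝ} (hρ : 0 ≤ ρ) (hεd : 0 ≤ εd) :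
    (ρ + εd * 2 < 3133 / 2500 * (ε ^ 2 * exp (-M)) / Real.sqrt M →
        Nonempty (ReachCertificate (delayCircuitWith K M ε) (ball (0 : Fin 5 → ℝ) 2) εd 2
          (closedBall delayInit ρ) (firedSet K 6 4))) ∧
    (2507 / 2000 * (ε ^ 2 * exp (-M)) / Real.sqrt M ≤ ρ →
        IsEmpty (ReachCertificate (delayCircuitWith K M ε) (ball (0 : Fin 5 → ℝ) 2) εd 2
          (closedBall delayInit ρ) (firedSet K 6 4))) ∧
    (ε ^ 2 * exp (-M) ≤ εd → ∀ τc : ℝ, 0 ≤ τc →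
        IsEmpty (ReachCertificate (delayCircuitWith K M ε) (ball (0 : Fin 5 → ℝ) 2) εd τc
          (closedBall delayInit ρ) (firedSet K 6 4))) := by
  obtain ⟨hK16, -, -, -, -, -⟩ := negKick_params hK hML hMK hε hεle
  exact ⟨fun hB => ⟨taoReachSharp hK hML hMK hε hεle hρ hεd hB⟩,
    fun hρ' => isEmpty_taoReach_of_ge hK hML hMK hε hεle hεd hρ',
    fun hs τc hτ => isEmpty_taoReach_of_seed_le (by linarith) hρ hs hτ⟩

/-- The two impossibility levels compared: the seed rate dominates the pre-load level by the factor
`√M/1.2535 ≥ 61` (`√M ≥ 77`): `1.2535·u < ε²e^{-M}`. So on the segment `ρ + 2εd = B` the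
pre-load corner is the binding one, and the file's two-sided threshold (§4–§5) is a statement about
pre-load; the defect axis alone is decided only up to the factor of §5b.
[cite: Tao2016AveragedNS, §5.5 Theorem 5.3] -/
theorem dud_level_lt_seed : 2507 / 2000 * (ε ^ 2 * exp (-M)) / Real.sqrt M < ε ^ 2 * exp (-M) := by
  obtain ⟨-, -, -, -, -, -, -, h77, -⟩ := Ignition.ignition_params hK hML hMK hε hεle
  have hs : 0 < ε ^ 2 * exp (-M) := by positivity
  have hsq0 : 0 < Real.sqrt M := by linarith
  rw [div_lt_iff₀ hsq0]
  nlinarith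

end Radius

/-! ## §8. Versus the Grönwall certificate -/

/-- `e^{-16/ε²}·√M < ε²e^{-M}` in the regime `0 < ε ≤ 1`, `Mε ≤ 1/40`, `√M ≤ M`, `0 < M`
(so `M ≤ 1/ε²` and `e^{-15/ε²} ≤ 2ε⁴/225`). [folklore] -/
theorem exp_neg_sixteen_div_sq_mul_sqrt_lt {M ε : ℝ} (hε : 0 < ε) (hε1 : ε ≤ 1) (hM : 0 < M)
    (hMε : M * ε ≤ 1 / 40) (hsqM : Real.sqrt M ≤ M) :
    exp (-(16 / ε ^ 2)) * Real.sqrt M < ε ^ 2 * exp (-M) := by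
  have hε2 : 0 < ε ^ 2 := by positivity
  have hMle : M ≤ 1 / ε ^ 2 := by
    rw [le_div_iff₀ hε2]
    have : M * ε * ε ≤ 1 / 40 * 1 := mul_le_mul hMε hε1 hε.le (by norm_num)
    nlinarith
  have hsplit : exp (-(16 / ε ^ 2)) ≤ exp (-M) * exp (-(15 / ε ^ 2)) := by
    rw [← Real.exp_add]
    refine Real.exp_le_exp.2 ?_
    have : (16 : ℝ) / ε ^ 2 = 1 / ε ^ 2 + 15 / ε ^ 2 := by ring
    linarith
  have hy : (0 : ℝ) ≤ 15 / ε ^ 2 := by positivity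
  have hquad := Real.quadratic_le_exp_of_nonneg hy
  have hexp15 : exp (-(15 / ε ^ 2)) ≤ 2 * ε ^ 4 / 225 := by
    have hpos : 0 < exp (15 / ε ^ 2) := exp_pos _
    have hq : (15 / ε ^ 2) ^ 2 / 2 ≤ exp (15 / ε ^ 2) := by linarith
    have hq' : (15 / ε ^ 2) ^ 2 / 2 = 225 / (2 * ε ^ 4) := by
      field_simp
      ring
    rw [Real.exp_neg, inv_le_comm₀ hpos (by positivity)]
    rw [hq'] at hq
    have : (2 * ε ^ 4 / 225)⁻¹ = 225 / (2 * ε ^ 4) := by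
      rw [inv_div]
    rw [this]
    exact hq
  have hsq0 : 0 ≤ Real.sqrt M := Real.sqrt_nonneg _
  have hexpM : 0 < exp (-M) := exp_pos _
  calc exp (-(16 / ε ^ 2)) * Real.sqrt M
      ≤ exp (-M) * exp (-(15 / ε ^ 2)) * Real.sqrt M := by gcongr
    _ ≤ exp (-M) * (2 * ε ^ 4 / 225) * M := by gcongr
    _ = exp (-M) * (2 * ε ^ 3 / 225) * (M * ε) := by ring
    _ ≤ exp (-M) * (2 * ε ^ 3 / 225) * (1 / 40) := by gcongr
    _ = ε / 4500 * (ε ^ 2 * exp (-M)) := by ring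
    _ < ε ^ 2 * exp (-M) := by
        have hpos : 0 < ε ^ 2 * exp (-M) := by positivity
        exact (mul_lt_iff_lt_one_left hpos).2 (by linarith)

section Gronwall

variable {K M ε : ℝ} (hK : 2 * 20 ^ 42 * (Nat.factorial 42 : ℝ) + 16 ≤ K)
  (hML : 3000 * Real.log K ≤ M) (hMK : M ≤ K ^ 10) (hε : 0 < ε)
  (hεle : ε ≤ exp (-(10 * M)) / K ^ 100)
include hK hML hMK hε hεle

/-- **The Grönwall radius is below the sharp budget**: `shadowRadiusWith K M ε 2 2 θ < 1.2532·u` for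
`0 ≤ θ ≤ 1` (indeed `shadowRadiusWith ≤ θe^{-16/ε²}` by `shadowRadiusWith_le`, and
`e^{-16/ε²} < ε²e^{-M}/√M`). [cite: HairerNorsettWanner1993, Thm I.10.2] -/
theorem shadowRadiusWith_lt_sharp {θ : ℝ} (hθ0 : 0 ≤ θ) (hθ1 : θ ≤ 1) :
    shadowRadiusWith K M ε 2 2 θ < 3133 / 2500 * (ε ^ 2 * exp (-M)) / Real.sqrt M := by
  obtain ⟨hM6000, hε1, -, -, hMε, -, -, -, hsqM⟩ := Ignition.ignition_params hK hML hMK hε hεle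
  have hK0 : (0 : ℝ) ≤ K := by linarith [(negKick_params hK hML hMK hε hεle).1]
  have hM0 : 0 < M := by linarith
  have hsq0 : 0 < Real.sqrt M := Real.sqrt_pos.2 hM0
  have h1 : shadowRadiusWith K M ε 2 2 θ ≤ θ * exp (-(16 / ε ^ 2)) := by
    have h := shadowRadiusWith_le (R := 2) (T := 2) (K := K) (M := M) hK0 hM0.le hε
      (by norm_num) hθ0
    refine h.trans_eq ?_
    norm_num
  have h2 := exp_neg_sixteen_div_sq_mul_sqrt_lt hε hε1 hM0 hMε hsqM
  have h3 : exp (-(16 / ε ^ 2)) < ε ^ 2 * exp (-M) / Real.sqrt M := by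
    rw [lt_div_iff₀ hsq0]
    exact h2
  have h4 : ε ^ 2 * exp (-M) / Real.sqrt M ≤ 3133 / 2500 * (ε ^ 2 * exp (-M)) / Real.sqrt M :=
    div_le_div_of_nonneg_right (by nlinarith [mul_pos (pow_pos hε 2) (exp_pos (-M))]) hsq0.le
  have h5 : θ * exp (-(16 / ε ^ 2)) ≤ exp (-(16 / ε ^ 2)) := by
    have := exp_pos (-(16 / ε ^ 2))
    nlinarith
  linarith

end Gronwall

/-- **Every Grönwall gate budget is a sharp reach budget**: `GateBudgetWith K M ε ρ εd θ`
(GateCertificateWith.lean: `(ρ + 2εd)e^{2L·2}… ≤ θ ≤ 1/4`, i.e. `ρ + 2εd ≤ shadowRadiusWith K M ε 2 2 θ`)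
forces `ρ + 2εd < 1.2532·ε²e^{-M}/√M`. [cite: HairerNorsettWanner1993, Thm I.10.2] -/
theorem GateBudgetWith.budget_lt_sharp {K M ε ρ εd θ : ℝ} (h : GateBudgetWith K M ε ρ εd θ) :
    ρ + εd * 2 < 3133 / 2500 * (ε ^ 2 * exp (-M)) / Real.sqrt M := by
  have h1 : ρ + εd * 2 ≤ shadowRadiusWith K M ε 2 2 θ := by
    have hb := h.budget
    have hE := Real.exp_pos (delayLipschitzWith K M ε 2 * 2)
    unfold shadowRadiusWith
    rw [Real.exp_neg, ← div_eq_mul_inv]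
    exact (le_div_iff₀ hE).2 hb
  have h2 := shadowRadiusWith_lt_sharp h.hK h.hML h.hMK h.ε_pos h.ε_le h.θ_pos.le
    (h.θ_le.trans (by norm_num))
  linarith

/-- **The Grönwall certificate's data, re-certified sharply**: every gate budget of
GateCertificateWith.lean yields a sharp reach certificate with the same input radius and defect
(and no efficiency loss). [cite: Tao2016AveragedNS, §5.5 Theorem 5.3] -/
def GateBudgetWith.reachCertificate {K M ε ρ εd θ : ℝ} (h : GateBudgetWith K M ε ρ εd θ) :
    ReachCertificate (delayCircuitWith K M ε) (ball (0 : Fin 5 → ℝ) 2) εd 2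
      (closedBall delayInit ρ) (firedSet K 6 4) :=
  taoReachSharp h.hK h.hML h.hMK h.ε_pos h.ε_le h.ρ_pos.le h.εd_nonneg h.budget_lt_sharp

end Literature.Analysis.FluidPDE.Tao2016AveragedNS
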